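import Summits.ValiantsHypothesis.ValiantsHypothesis.Theses.SliceSignRank
import Summits.ValiantsHypothesis.ValiantsHypothesis.Theorems.TwistedDetRankFermionicNormalFormSummitHard
import Literature.Computability.AlgebraicComplexity.ArithCircuitProofs

/-!
# Crux `SliceSignRank.PositiveSliceNormalForm` (stmt-ValiantsHypothesis-15119) alone implies the summit

CALIBRATION for the redirect strategist of crux `SignRankSuperQP` (stmt-ValiantsHypothesis-15118),
kernel-checked and elementary: the route's SECOND crux FNF⁺ = `PositiveSliceNormalForm` ALONE gives
`VP ℂ ≠ VNP ℂ` (`valiantsHypothesis_of_positiveSliceNormalForm`), so the deciding crux SRK =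
`SignRankSuperQP` is NOT load-bearing in `closes : SignRankSuperQP → PositiveSliceNormalForm →
ValiantsHypothesis`, and FNF⁺ is at least as strong as the summit (the judge's "smuggling" flag lands
on stmt-15119, not on SRK).  Conversely the target PPC gives FNF⁺ vacuously
(`positiveSliceNormalForm_of_positivePatternHard`).

Proof.  Under `VP ℂ = VNP ℂ` both `per` (`perFamily_mem_VNP_holds`) and `HC` (`hcFamily_mem_VNP`) are
`IsVPFamily`, hence so is `f_n := per_n + HC_n` (`IsPBounded.add_holds`, `complexity_add_le_holds`,
`totalDegree_add`).  It is slice-supported with coefficients `1 + [σ is an n-cycle] ∈ {1, 2}`, all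
real positive, so FNF⁺ yields `c` and, for every `n ≥ 1`, `r ≤ 2^((log₂ n + c)^c)` real twists with
`1 + [σ ∈ HC] = sgn σ · Σ_t Π_i W_t(σ i, i)`.  AUGMENTED BLOCK-SWAP FLATTENING: on the sibling's test
permutations `testPerm x y` (`x y : Fin (k+1) → Bool`, `n = (2k+2)+(2k+2)`; an `n`-cycle iff `x = y`,
`cycleType_testPerm_iff`) the identity reads `U · V = 1 + J`, so `[U | -1] · [V ; 1] = 1` and
`2^{k+1} ≤ r + 1` (`card_le_succ_of_mul_eq`); at `k + 1 = 2^j` this is `2^(2^j) ≤ 2^((j+2+c)^c) + 1`,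
absurd for the `j` of `directSumToTdr_exists_pow_add_lt`.  References: Valiant, STOC 1979;
Bürgisser 2000, Ch. 2; Landsberg 2017, §6 (flattenings).  No named facts assumed.
-/

-- single-conjunct layout: Sub = Summit, duplicated namespace component intended
set_option linter.dupNamespace false

noncomputable section

namespace Summit.ValiantsHypothesis.ValiantsHypothesis.Theorems.SliceSignRankPositiveSliceNormalForm

open Equiv MvPolynomial Literature.Computability.AlgebraicComplexity
open Summit.ValiantsHypothesis.ValiantsHypothesis.Theorems.TwistedDetRankFermionicNormalForm
open scoped BigOperators

/-! ## §1 The coefficients of `HC_n` on the permutation slice -/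

/-- `HC_n` as a combination of permutation monomials. [folklore] -/
theorem hcPoly_eq_sum_monomial (n : ℕ) :
    hcPoly (Fin n) ℂ =
      ∑ σ : Perm (Fin n), monomial (permMonomial σ) (if σ.cycleType = {n} then (1 : ℂ) else 0) := by
  rw [← hcPoly_eq_gmf]
  refine Finset.sum_congr rfl fun σ _ => ?_
  rw [TwistedDetRankTdrSuperadditive.prod_X_eq_monomial, C_mul_monomial, mul_one]

/-- The coefficient of the permutation monomial of `τ` in `HC_n` is `[τ is an n-cycle]`. [folklore] -/
theorem coeff_permMonomial_hcPoly {n : ℕ} (τ : Perm (Fin n)) :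
    coeff (permMonomial τ) (hcPoly (Fin n) ℂ) = if τ.cycleType = {n} then (1 : ℂ) else 0 := by
  rw [hcPoly_eq_sum_monomial]
  exact TwistedDetRankTdrSuperadditive.coeff_permMonomial_sum_monomial _ τ

/-- `HC_n` is supported on the permutation slice. [folklore] -/
theorem coeff_hcPoly_eq_zero {n : ℕ} {d : Fin n × Fin n →₀ ℕ}
    (hd : ∀ ρ : Perm (Fin n), permMonomial ρ ≠ d) : coeff d (hcPoly (Fin n) ℂ) = 0 := by
  rw [hcPoly_eq_sum_monomial, coeff_sum]
  exact Finset.sum_eq_zero fun ρ _ => by rw [coeff_monomial, if_neg (hd ρ)]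

/-! ## §2 The augmented flattening -/

/-- Affine rank bound: if `U · V = 1 + J` (`J` the all-ones matrix) with inner dimension `r`, then
`#ι ≤ r + 1` — border `U` with the column `-1` and `V` with the row `1`. [folklore] -/
theorem card_le_succ_of_mul_eq {ι : Type*} [Fintype ι] [DecidableEq ι] {r : ℕ}
    (U : Matrix ι (Fin r) ℂ) (V : Matrix (Fin r) ι ℂ)
    (h : ∀ x y, (U * V) x y = 1 + if x = y then 1 else 0) :
    Fintype.card ι ≤ r + 1 := by
  classical
  set U' : Matrix ι (Fin r ⊕ Unit) ℂ := Matrix.fromCols U (Matrix.of fun _ _ => (-1 : ℂ)) with hU'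
  set V' : Matrix (Fin r ⊕ Unit) ι ℂ := Matrix.fromRows V (Matrix.of fun _ _ => (1 : ℂ)) with hV'
  have hUV : U' * V' = 1 := by
    ext x y
    rw [hU', hV', Matrix.fromCols_mul_fromRows, Matrix.add_apply, h x y, Matrix.one_apply,
      Matrix.mul_apply]
    simp only [Matrix.of_apply, Finset.univ_unique, Finset.sum_singleton]
    split_ifs <;> norm_num
  have h1 : (1 : Matrix ι ι ℂ).rank = Fintype.card ι := Matrix.rank_one
  have h2 : (U' * V').rank ≤ r + 1 := by
    refine (Matrix.rank_mul_le_left U' V').trans ((Matrix.rank_le_card_width U').trans ?_)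
    simp
  rw [hUV, h1] at h2
  exact h2

/-- **Augmented flattening bound.** If `1 + [σ is an n-cycle]`, `n = 4k+4`, is a cone sum of length
`r` in coefficient form, then `2^{k+1} ≤ r + 1`: on the test permutations `σ_{x,y}` the identity reads
`1 + 𝟙 = U · V` for a `2^{k+1} × r` matrix `U`. [folklore; Landsberg 2017 §6] -/
theorem two_pow_le_succ_of_repr {k r : ℕ}
    (E : Fin r → Matrix (Fin ((2 * k + 2) + (2 * k + 2))) (Fin ((2 * k + 2) + (2 * k + 2))) ℂ)
    (hrep : ∀ σ : Perm (Fin ((2 * k + 2) + (2 * k + 2))),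
      (1 : ℂ) + (if σ.cycleType = {(2 * k + 2) + (2 * k + 2)} then (1 : ℂ) else 0) =
        ∑ t, ((Perm.sign σ : ℤ) : ℂ) * ∏ i, E t (σ i) i) :
    2 ^ (k + 1) ≤ r + 1 := by
  classical
  set eS : Fin (2 * k + 2) ⊕ Fin (2 * k + 2) ≃ Fin ((2 * k + 2) + (2 * k + 2)) := finSumFinEquiv
    with heS
  set c : Perm (Fin (2 * k + 2)) := finRotate (2 * k + 2) with hc
  set ε : ℂ := ((Perm.sign (Equiv.sumComm (Fin (2 * k + 2)) (Fin (2 * k + 2)) :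
      Perm (Fin (2 * k + 2) ⊕ Fin (2 * k + 2))) : ℤ) : ℂ) with hε
  set U : Matrix (Fin (k + 1) → Bool) (Fin r) ℂ := fun x t =>
    ε * ((Perm.sign (pairSwap x) : ℤ) : ℂ) *
      ∏ i, E t (eS (Sum.inr (pairSwap x i))) (eS (Sum.inl i)) with hU
  set V : Matrix (Fin r) (Fin (k + 1) → Bool) ℂ := fun t y =>
    ((Perm.sign (c * pairSwap y) : ℤ) : ℂ) *
      ∏ i, E t (eS (Sum.inl ((c * pairSwap y) i))) (eS (Sum.inr i)) with hV
  have hUV : ∀ x y, (U * V) x y = 1 + if x = y then 1 else 0 := by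
    intro x y
    rw [Matrix.mul_apply]
    have h := hrep (testPerm x y)
    rw [if_congr (cycleType_testPerm_iff x y) rfl rfl] at h
    rw [h]
    refine Finset.sum_congr rfl fun t _ => ?_
    -- sign
    have hsign : ((Perm.sign (testPerm x y) : ℤ) : ℂ) =
        ε * ((Perm.sign (pairSwap x) : ℤ) : ℂ) * ((Perm.sign (c * pairSwap y) : ℤ) : ℂ) := by
      rw [testPerm, Perm.sign_permCongr, sign_swapPerm, hε, hc]
      push_cast
      ring
    -- product
    have hprod : ∏ i, E t (testPerm x y i) i =
        (∏ i, E t (eS (Sum.inr (pairSwap x i))) (eS (Sum.inl i))) *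
          ∏ i, E t (eS (Sum.inl ((c * pairSwap y) i))) (eS (Sum.inr i)) := by
      rw [← Equiv.prod_comp eS (fun i => E t (testPerm x y i) i)]
      have hq : ∀ z, testPerm x y (eS z) = eS (swapPerm (pairSwap x) (c * pairSwap y) z) := by
        intro z
        simp [testPerm, heS, hc, Equiv.permCongr_apply]
      simp_rw [hq]
      exact prod_swapPerm (pairSwap x) (c * pairSwap y) (fun u v => E t (eS u) (eS v))
    rw [hsign, hprod, hU, hV]
    ring
  have h := card_le_succ_of_mul_eq U V hUV
  rwa [Fintype.card_fun, Fintype.card_bool, Fintype.card_fin] at h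

/-! ## §3 FNF⁺ alone is summit-hard; PPC gives FNF⁺ for free -/

/-- **PPC ⇒ FNF⁺** (vacuously: under `PositivePatternHard` no positive slice family is in `VP`, so the
normal-form statement has an absurd hypothesis).  Together with the route's `CruxesToTarget`
(`SRK → FNF⁺ → PPC`) this says: GIVEN SRK, FNF⁺ ≡ PPC, which is strictly stronger than the summit. -/
theorem positiveSliceNormalForm_of_positivePatternHard :
    Summit.ValiantsHypothesis.ValiantsHypothesis.Theses.SliceSignRank.PositivePatternHard →
      Summit.ValiantsHypothesis.ValiantsHypothesis.Theses.SliceSignRank.PositiveSliceNormalForm := by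
  intro hP f h0 h1 hVP
  exact absurd hVP (hP f h0 h1)

/-- **CALIBRATION — the crux FNF⁺ alone implies the summit.**
`PositiveSliceNormalForm → VP ℂ ≠ VNP ℂ`: under `VP ℂ = VNP ℂ` the family `per_n + HC_n` is a
positive slice `VP` family with coefficients `1 + [σ ∈ HC]`; FNF⁺ bounds its real twisted
representations by `2^((log₂ n + c)^c)` while the augmented block-swap flattening
(`two_pow_le_succ_of_repr`) forces length `≥ 2^{n/4} - 1` at `n = 2^{j+2}`; `2^(2^j) ≤ 2^((j+2+c)^c) + 1`
fails for the `j` of `directSumToTdr_exists_pow_add_lt`.  Hence `SignRankSuperQP` is redundant in the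
route's `closes`, and FNF⁺ is at least as hard as `ValiantsHypothesis`. [folklore] -/
theorem valiantsHypothesis_of_positiveSliceNormalForm :
    Summit.ValiantsHypothesis.ValiantsHypothesis.Theses.SliceSignRank.PositiveSliceNormalForm →
      _root_.ValiantsHypothesis := by
  intro hF
  show VP ℂ ≠ VNP ℂ
  intro hEq
  -- `per` and `HC` are p-computable p-families under `VP = VNP`
  have hper : IsVPFamily (fun n => perPoly (Fin n) ℂ) :=
    (mem_VP_ofFintype_iff_holds (fun n => perPoly (Fin n) ℂ)).1
      (by rw [hEq]; exact perFamily_mem_VNP_holds ℂ)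
  have hhc : IsVPFamily (fun n => hcPoly (Fin n) ℂ) :=
    (mem_VP_ofFintype_iff_holds (fun n => hcPoly (Fin n) ℂ)).1
      (by rw [hEq]; exact hcFamily_mem_VNP ℂ)
  -- hence so is `per + HC`
  have hVP : IsVPFamily (fun n => perPoly (Fin n) ℂ + hcPoly (Fin n) ℂ) := by
    refine ⟨⟨hper.1.1, ?_⟩, ?_⟩
    · exact (IsPBounded.add_holds hper.1.2 hhc.1.2).mono fun n =>
        (totalDegree_add _ _).trans (max_le (Nat.le_add_right _ _) (Nat.le_add_left _ _))
    · exact (IsPBounded.add_holds (IsPBounded.add_holds hper.2 hhc.2) (IsPBounded.const 1)).mono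
        fun n => complexity_add_le_holds _ _
  -- `per + HC` is a positive slice family with coefficients `1 + [σ ∈ HC]`
  have h0 : ∀ (n : ℕ) (d : Fin n × Fin n →₀ ℕ), (∀ ρ : Perm (Fin n), permMonomial ρ ≠ d) →
      coeff d (perPoly (Fin n) ℂ + hcPoly (Fin n) ℂ) = 0 := by
    intro n d hd
    rw [coeff_add, coeff_perPoly, coeff_hcPoly_eq_zero hd, add_zero]
    exact Finset.sum_eq_zero fun ρ _ => if_neg (hd ρ)
  have hcoeff : ∀ (n : ℕ) (ρ : Perm (Fin n)),
      coeff (permMonomial ρ) (perPoly (Fin n) ℂ + hcPoly (Fin n) ℂ) =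
        1 + if ρ.cycleType = {n} then (1 : ℂ) else 0 := by
    intro n ρ
    rw [coeff_add, coeff_permMonomial_perPoly, coeff_permMonomial_hcPoly]
  have h1 : ∀ (n : ℕ) (ρ : Perm (Fin n)), ∃ r : ℝ, 0 < r ∧
      coeff (permMonomial ρ) (perPoly (Fin n) ℂ + hcPoly (Fin n) ℂ) = (r : ℂ) := by
    intro n ρ
    refine ⟨1 + if ρ.cycleType = {n} then (1 : ℝ) else 0, by positivity, ?_⟩
    rw [hcoeff]
    split_ifs <;> push_cast <;> ring
  obtain ⟨c, hc⟩ := hF _ h0 h1 hVP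
  -- growth: `2^j ≤ (j + 2 + c)^c` for all `j` is absurd
  obtain ⟨j, hj⟩ := directSumToTdr_exists_pow_add_lt 1 one_pos (c + 2) c
  set k : ℕ := 2 ^ j - 1 with hk
  have hk1 : k + 1 = 2 ^ j := by have := Nat.one_le_two_pow (n := j); omega
  have hn : (2 * k + 2) + (2 * k + 2) = 2 ^ (j + 2) := by rw [pow_succ, pow_succ, ← hk1]; ring
  obtain ⟨r, hr, W, hW⟩ := hc ((2 * k + 2) + (2 * k + 2)) (by omega)
  rw [hn, Nat.log_pow one_lt_two] at hr
  -- coefficient form over `ℂ`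
  have hrep : ∀ σ : Perm (Fin ((2 * k + 2) + (2 * k + 2))),
      (1 : ℂ) + (if σ.cycleType = {(2 * k + 2) + (2 * k + 2)} then (1 : ℂ) else 0) =
        ∑ t, ((Perm.sign σ : ℤ) : ℂ) *
          ∏ i, (Matrix.of fun a b => ((W t a b : ℝ) : ℂ)) (σ i) i := by
    intro σ
    rw [← hcoeff, hW σ, Finset.mul_sum]
    simp only [Matrix.of_apply]
  have h2 : 2 ^ (k + 1) ≤ r + 1 := two_pow_le_succ_of_repr _ hrep
  rw [hk1] at h2
  -- `2^(2^j) ≤ 2^((j+2+c)^c) + 1 < 2^((j+2+c)^c + 1)` gives `2^j ≤ (j+2+c)^c`, contradicting `hj`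
  have h3 : 2 ^ j ≤ (j + (c + 2)) ^ c := by
    have hlt : 1 < 2 ^ ((j + 2 + c) ^ c) := Nat.one_lt_two_pow (pow_pos (by omega) c).ne'
    have h4 : 2 ^ (2 ^ j) < 2 ^ ((j + 2 + c) ^ c + 1) := by
      calc 2 ^ (2 ^ j) ≤ 2 ^ ((j + 2 + c) ^ c) + 1 := h2.trans (Nat.add_le_add_right hr 1)
        _ < 2 ^ ((j + 2 + c) ^ c) + 2 ^ ((j + 2 + c) ^ c) := Nat.add_lt_add_left hlt _
        _ = 2 ^ ((j + 2 + c) ^ c + 1) := by rw [pow_succ]; ring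
    have h5 := (Nat.pow_lt_pow_iff_right (by norm_num : 1 < 2)).1 h4
    rw [show j + (c + 2) = j + 2 + c by ring]
    omega
  have h6 : ((2 ^ j : ℕ) : ℝ) ≤ (((j + (c + 2)) ^ c : ℕ) : ℝ) := by exact_mod_cast h3
  push_cast at h6 hj
  linarith

end Summit.ValiantsHypothesis.ValiantsHypothesis.Theorems.SliceSignRankPositiveSliceNormalForm

end
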